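import Literature.NumberTheory.Automorphic.Liu2021.LemD1AsPrintedIndexedNonVacuityInertCarrier
import Literature.NumberTheory.GaloisRepresentations.AdicCompletionUnitRoots
import HarnessLib

/-!
# [Liu2021, App. D Lemma D.1 (3)] bookkeeping — the CONVERSE at inert TAME places of ANY quadratic `E/F`: for `v_w(N) = 1` and
# `gcd(N, q_v + 1) = 1` the norm-one group `E_v¹` is `N`-DIVISIBLE, so NO det-line carrier with trivial central character exists there

Reproduction ∕ bookkeeping (Literature, THEOREMS ONLY: no definition, no record, no named fact, no `sorry`; nothing is
asserted about Liu's oscillator representations or about the tree's constructed local Weil carriers).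

Sequel of ✔ `…InertFrobenius.lean` (v2 §5: `#κ(w)¹ = q_v + 1`, residue Hilbert 90, `κ(w)¹ = (κ(w)¹)^N` for `N` coprime to `q_v + 1`)
and ✔ `…InertCarrier.lean` (the det-line carrier `Ψ = θ ∘ det` at inert places with `gcd(N, q_v + 1) > 1`).  Those files name as NOT given
«the converse at inert tame places (`gcd(N, q_v(q_v + 1)) = 1 ⇒ E_w¹ = (E_w¹)^N`, which needs Hensel's lemma in `E_w`)».  THIS FILE proves
it, for ANY quadratic extension of number fields `E/F` (`c ≠ 1`), at every place `v` UNRAMIFIED in `E` and `w ∣ v` with `c • w = w`: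

* §1 (local, any `E_w`) `valued_pow_sub_one_eq` (`v_w(t^N − 1) = v_w(t − 1)` for a principal unit `t` when `v_w(N) = 1`), hence
  `eq_one_of_pow_eq_one_of_valued_sub_one_lt` — the principal units carry NO prime-to-`p` torsion; `valued_pow_sub_pow_le`.
* §2 **the conjugation `c_w = galAdicCompletionMap c hw` of the COMPLETION `E_w` is the `q_v`-Frobenius modulo `𝔪_w`**:
  `valued_galAdicCompletionMap_sub_pow_lt_one` (`v_w(c_w(y) − y^{q_v}) < 1` for `v_w(y) ≤ 1`; density of `𝓞_E` in `𝒪_w`,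
  ✔ `exists_ringOfIntegers_valued_sub_lt_one`, + the global congruence of ✔ `…InertFrobenius.smul_sub_pow_card_mem`), and
  `galAdicCompletionMap_eq_pow_of_pow_eq_one` (`c_w(ζ) = ζ^{q_v}` for every `N`-th root of unity `ζ ∈ E_w`, `v_w(N) = 1`).
* §3 **`exists_pow_eq_of_mul_galAdicCompletionMap_eq_one`** — `E_w¹ = (E_w¹)^N`: for `v_w(N) = 1` and `gcd(N, q_v + 1) = 1`, every `z ∈ E_w`
  with `z · c_w(z) = 1` is `y^N` with `y · c_w(y) = 1`.  PROOF: approximate `z` by `u ∈ 𝓞_E`; `\bar u ∈ κ(w)¹ = (κ(w)¹)^N` is the class of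
  `(u' ∕ c u')^N` (✔ `…InertFrobenius` §5); `z' = z ∕ g^N`, `g = u' ∕ c(u')`, is a norm-one principal unit, so `z' = r^N` (Hensel, tree
  ✔ `exists_pow_eq_of_norm_sub_one_lt`); `t = r · c_w(r)` is an `N`-th root of unity and, with `a N + b (q_v + 1) = 1` and `ζ = t^{−b}`,
  `ζ · c_w(ζ) = ζ^{q_v + 1} = t^{−1}` (§2), so `y = g · r ζ` works.
* §4 (place model of [Liu2021, App. D §D.1], `S = LemD1OfPlace.standingData …`, any hermitian `J`, `N ≥ 2`)
  **`exists_pow_eq_of_mem_normOne`** (`S.normOne = E_v¹` is `N`-divisible; the component at the unique place `w ∣ v` determines an element of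
  `E_v = Π_{w' ∣ v} E_{w'}`), `forall_apply_eq_one_of_forall_pow`, and the headline **`eq_one_of_factors_through_det`**: EVERY character `Ψ` of
  `U(V)(F_v) = S.U` that factors through `det` and is trivial on the centre `S.scalar(E_v¹)` is TRIVIAL (`det(z · 1_N) = z^N`) — the exact
  negation of the conclusion of ✔ `…InertCarrier.exists_inert_carrier_character` (which needs `gcd(N, q_v + 1) > 1`).
* §5 the CM rows (`L` CM, `F = L⁺`, `c` = complex conjugation): the same; for THE END's `N = 3`: every inert place `v` of `L⁺` unramified in `L`
  with `v ∤ 3` and `q_v ≢ 2 (mod 3)` carries NO det-line `μ`-separating carrier.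

Picture for an auditor of the END rows `hD1''` ∕ `hD3` (our bookkeeping, not a claim about Liu's objects): the det-line device of the lineage
(✔ DetCarrier ∕ TorsionCarrier ∕ WildCarrier ∕ InertCarrier) realises the `μ`-ALONE separation of [Lem. D.1 (3)] AS PRINTED exactly at: split
places, places above a prime dividing `N`, non-split places seeing a norm-one `N`-torsion, inert places with `gcd(N, q_v + 1) > 1`; and, by this
file, at NO OTHER INERT place (tame, `gcd(N, q_v + 1) = 1`).  Whether NON-line carriers separate there is a different question (not treated);
ramified non-split places are not treated either.

What this does NOT give: ramified non-split places (`N` odd: `E_w¹ ∕ (E_w¹)^N` there); carriers that do not factor through `det`; anything about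
the rows' OWN carriers `𝓢.omegaLoc v`; Lem. D.1 itself.  HC_CM is NOT proved.

Cell pub-hodgecm2 (COR-CM), audit class of the END rows `hD1''` ∕ `hD3`; seat prover-pub-hodgecm2-b10.

References: [Liu2021] Y. Liu, *Fourier–Jacobi cycles and arithmetic relative trace formula*, Camb. J. Math. 9 (2021) =
arXiv:2102.11518, App. D §D.1 (l. 5213–5221), Lemma D.1 (3) (l. 5233); [Mok2014] C. P. Mok, Mem. AMS 235 (2015), §1 Notation p. 5;
[NeukirchANT1999] J. Neukirch, *Algebraic Number Theory* (1999), Ch. I §9 Exercise 2 (Frobenius), Ch. II §3 Prop. (3.10), §4 Prop. (4.3)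
(`𝒪 ∕ 𝔭 = 𝒪_v ∕ 𝔭_v`) and Lemma (4.6) (Hensel), §5 Prop. (5.3) (`U^{(1)}`); [CasselsFrohlichANT1967] Ch. II §10, Ch. VII §1.1.
-/

noncomputable section

open scoped Matrix MatrixGroups Valued
open NumberField IsDedekindDomain
open Literature.RepresentationTheory
open Literature.RepresentationTheory.Liu2021 (OscillatorStandingData)
open Literature.NumberTheory.GaloisRepresentations (HeckeCharacter)

namespace Literature.NumberTheory.Automorphic.Liu2021.LemD1IndexedNonVacuityInertConverse

open UnitaryGroup

/-! ## §1 Local lemmas in `E_w`: no prime-to-`p` torsion among principal units; `v_w(a^k − b^k) ≤ v_w(a − b)` -/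

section Local

variable {E : Type} [Field E] [NumberField E] (w : HeightOneSpectrum (𝓞 E))

/-- `v_w(k) ≤ 1` for a natural number `k`. [folklore] -/
private theorem valued_natCast_le_one (k : ℕ) : Valued.v ((k : w.adicCompletion E)) ≤ 1 := by
  induction k with
  | zero => simp
  | succ k ih =>
    rw [Nat.cast_succ]
    exact Valuation.map_add_le _ ih (by rw [Valuation.map_one])

/-- **`v_w(t^N − 1) = v_w(t − 1)` for a principal unit `t` and `N` prime to the residue characteristic** (`v_w(N) = 1`):
`t^N − 1 = (t − 1) · Σ_{i<N} t^i` and `Σ_{i<N} t^i ≡ N (mod 𝔪_w)` is a unit. [cite: NeukirchANT1999, Ch. II §3 Prop. (3.10) and §5 Prop. (5.3)] -/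
theorem valued_pow_sub_one_eq {N : ℕ} (hN : Valued.v ((N : w.adicCompletion E)) = 1) {t : w.adicCompletion E}
    (ht : Valued.v (t - 1) < 1) : Valued.v (t ^ N - 1) = Valued.v (t - 1) := by
  have htv : Valued.v t = 1 := by
    have := Valuation.map_one_add_of_lt Valued.v ht
    rwa [add_sub_cancel] at this
  have hpow : ∀ i : ℕ, Valued.v (t ^ i - 1) ≤ Valued.v (t - 1) := fun i => by
    rw [← geom_sum_mul, Valuation.map_mul]
    have hS : Valued.v (∑ j ∈ Finset.range i, t ^ j) ≤ 1 :=
      Valuation.map_sum_le _ fun j _ => by rw [Valuation.map_pow, htv, one_pow]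
    exact mul_le_of_le_one_left' hS
  have hsplit : (∑ i ∈ Finset.range N, t ^ i) = (N : w.adicCompletion E) + ∑ i ∈ Finset.range N, (t ^ i - 1) := by
    rw [Finset.sum_sub_distrib, Finset.sum_const, Finset.card_range, nsmul_eq_mul, mul_one, add_sub_cancel]
  have hS : Valued.v (∑ i ∈ Finset.range N, t ^ i) = 1 := by
    rw [hsplit, Valuation.map_add_eq_of_lt_left, hN]
    rw [hN]
    exact (Valuation.map_sum_le _ fun i _ => hpow i).trans_lt ht
  rw [← geom_sum_mul, Valuation.map_mul, hS, one_mul]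

/-- **no prime-to-`p` torsion among the principal units of `E_w`**: `v_w(N) = 1`, `v_w(t − 1) < 1`, `t^N = 1 ⇒ t = 1`.
[cite: NeukirchANT1999, Ch. II §5 Prop. (5.3)] -/
theorem eq_one_of_pow_eq_one_of_valued_sub_one_lt {N : ℕ} (hN : Valued.v ((N : w.adicCompletion E)) = 1)
    {t : w.adicCompletion E} (ht : Valued.v (t - 1) < 1) (htN : t ^ N = 1) : t = 1 := by
  have h := valued_pow_sub_one_eq w hN ht
  rw [htN, sub_self, Valuation.map_zero] at h
  exact (sub_eq_zero.1 ((Valuation.zero_iff _).1 h.symm))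

/-- `v_w(a^k − b^k) ≤ v_w(a − b)` for `v_w(a), v_w(b) ≤ 1` (`a^k − b^k = (a − b) Σ a^i b^{k−1−i}`; ultrametric inequality).
[cite: NeukirchANT1999, Ch. II §3 Prop. (3.10)] -/
theorem valued_pow_sub_pow_le {a b : w.adicCompletion E} (ha : Valued.v a ≤ 1) (hb : Valued.v b ≤ 1) (k : ℕ) :
    Valued.v (a ^ k - b ^ k) ≤ Valued.v (a - b) := by
  rw [← (Commute.all a b).geom_sum₂_mul k, Valuation.map_mul]
  have hS : Valued.v (∑ i ∈ Finset.range k, a ^ i * b ^ (k - 1 - i)) ≤ 1 :=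
    Valuation.map_sum_le _ fun i _ => by
      rw [Valuation.map_mul, Valuation.map_pow, Valuation.map_pow]
      exact mul_le_one' (pow_le_one' ha _) (pow_le_one' hb _)
  exact mul_le_of_le_one_left' hS

end Local

/-! ## §2 The conjugation `c_w` of `E_w` at an INERT place acts as the `q_v`-FROBENIUS on the residue field of the COMPLETION, and as
`ζ ↦ ζ^{q_v}` on the prime-to-`p` roots of unity of `E_w` -/

section Frobenius

variable {F : Type} (E : Type) [Field F] [NumberField F] [Field E] [NumberField E] [Algebra F E]
  [Algebra.IsQuadraticExtension F E] (c : E ≃ₐ[F] E) (v : HeightOneSpectrum (𝓞 F))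

/-- **`c_w` IS THE FROBENIUS on `𝒪_w ∕ 𝔪_w`** (the local form of ✔ `…InertFrobenius.smul_sub_pow_card_mem`): at an inert place (`v`
unramified in `E`, `c • w = w`), for every `y ∈ E_w` with `v_w(y) ≤ 1`, `v_w(c_w(y) − y^{q_v}) < 1` — by density of `𝓞_E` in `𝒪_w`
(✔ `exists_ringOfIntegers_valued_sub_lt_one`), the global congruence `c • u ≡ u^{q_v} (mod 𝔭_w)`, `v_w ∘ c_w = v_w` and
`v_w(a^q − y^q) ≤ v_w(a − y)`. [cite: NeukirchANT1999, Ch. I §9 Exercise 2 and Ch. II §4 Prop. (4.3)] -/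
theorem valued_galAdicCompletionMap_sub_pow_lt_one (hc : c ≠ 1) (hv : Algebra.IsUnramifiedIn (𝓞 E) v.asIdeal)
    (w : PlacesOver E v) (hw : c • w.1 = w.1) (y : w.1.adicCompletion E) (hy : Valued.v y ≤ 1) :
    Valued.v (galAdicCompletionMap c hw y - y ^ Nat.card (𝓞 F ⧸ v.asIdeal)) < 1 := by
  set q := Nat.card (𝓞 F ⧸ v.asIdeal) with hq
  -- a global integer `u` close to `y`
  obtain ⟨u, hu⟩ := Literature.NumberTheory.Automorphic.exists_ringOfIntegers_valued_sub_lt_one E w.1 ⟨y, hy⟩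
  set a : w.1.adicCompletion E := (((u : 𝓞 E) : E) : w.1.adicCompletion E) with ha
  have hua : algebraMap E (w.1.adicCompletion E) (algebraMap (𝓞 E) E u) = a := rfl
  rw [hua] at hu
  change Valued.v (a - y) < 1 at hu
  have hav : Valued.v a ≤ 1 := by
    rw [ha, HeightOneSpectrum.valuedAdicCompletion_eq_valuation', RingOfIntegers.coe_eq_algebraMap]
    exact HeightOneSpectrum.valuation_le_one w.1 u
  -- `c_w a = c u` and the global congruence
  have hca : galAdicCompletionMap c hw a = (((c • u : 𝓞 E) : E) : w.1.adicCompletion E) := by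
    rw [ha, galAdicCompletionMap_coe_algEquiv]
    rfl
  have hcong : Valued.v ((((c • u : 𝓞 E) : E) : w.1.adicCompletion E) - a ^ q) < 1 := by
    have : (((c • u : 𝓞 E) : E) : w.1.adicCompletion E) - a ^ q = (((c • u - u ^ q : 𝓞 E) : E) : w.1.adicCompletion E) := by
      have h1 : ((c • u - u ^ q : 𝓞 E) : E) = ((c • u : 𝓞 E) : E) - ((u : 𝓞 E) : E) ^ q := by push_cast; rfl
      rw [ha]
      change algebraMap E (w.1.adicCompletion E) ((c • u : 𝓞 E) : E) -
          (algebraMap E (w.1.adicCompletion E) ((u : 𝓞 E) : E)) ^ q =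
        algebraMap E (w.1.adicCompletion E) ((c • u - u ^ q : 𝓞 E) : E)
      rw [h1, map_sub, map_pow]
    rw [this, HeightOneSpectrum.valuedAdicCompletion_eq_valuation', RingOfIntegers.coe_eq_algebraMap,
      HeightOneSpectrum.valuation_lt_one_iff_mem]
    exact LemD1IndexedNonVacuityInertFrobenius.smul_sub_pow_card_mem E c v hc hv w hw u
  -- `c_w y − y^q = c_w (y − a) + (c_w a − a^q) + (a^q − y^q)`
  have hsplit : galAdicCompletionMap c hw y - y ^ q =
      galAdicCompletionMap c hw (y - a) + ((((c • u : 𝓞 E) : E) : w.1.adicCompletion E) - a ^ q) + (a ^ q - y ^ q) := by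
    rw [map_sub, hca]; ring
  rw [hsplit]
  refine (Valuation.map_add _ _ _).trans_lt (max_lt ((Valuation.map_add _ _ _).trans_lt (max_lt ?_ hcong)) ?_)
  · rw [valued_galAdicCompletionMap, Valuation.map_sub_swap]
    exact hu
  · exact (valued_pow_sub_pow_le w.1 hav hy q).trans_lt hu

/-- **`c_w(ζ) = ζ^{q_v}` for every root of unity `ζ ∈ E_w` of order prime to the residue characteristic** (`ζ^N = 1`, `v_w(N) = 1`): both
sides are `N`-th roots of unity congruent modulo `𝔪_w` (§2), and principal units carry no prime-to-`p` torsion (§1).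
[cite: NeukirchANT1999, Ch. I §9 Exercise 2 and Ch. II §5 Prop. (5.3)] -/
theorem galAdicCompletionMap_eq_pow_of_pow_eq_one (hc : c ≠ 1) (hv : Algebra.IsUnramifiedIn (𝓞 E) v.asIdeal)
    (w : PlacesOver E v) (hw : c • w.1 = w.1) {N : ℕ} (hN0 : N ≠ 0) (hN : Valued.v ((N : w.1.adicCompletion E)) = 1)
    {ζ : w.1.adicCompletion E} (hζ : ζ ^ N = 1) :
    galAdicCompletionMap c hw ζ = ζ ^ Nat.card (𝓞 F ⧸ v.asIdeal) := by
  set q := Nat.card (𝓞 F ⧸ v.asIdeal) with hq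
  have hζv : Valued.v ζ = 1 := (pow_eq_one_iff_left hN0).1 (by rw [← Valuation.map_pow, hζ, Valuation.map_one])
  have hζ0 : ζ ≠ 0 := fun h => by rw [h, Valuation.map_zero] at hζv; exact zero_ne_one hζv
  have hζq0 : ζ ^ q ≠ 0 := pow_ne_zero _ hζ0
  have hlt := valued_galAdicCompletionMap_sub_pow_lt_one E c v hc hv w hw ζ hζv.le
  -- `t = c_w ζ / ζ^q` is a principal unit with `t^N = 1`
  set t := galAdicCompletionMap c hw ζ * (ζ ^ q)⁻¹ with ht
  have ht1 : Valued.v (t - 1) < 1 := by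
    have hrw : t - 1 = (galAdicCompletionMap c hw ζ - ζ ^ q) * (ζ ^ q)⁻¹ := by
      rw [ht, sub_mul, mul_inv_cancel₀ hζq0]
    rw [hrw, Valuation.map_mul, map_inv₀, Valuation.map_pow, hζv, one_pow, inv_one, mul_one]
    exact hlt
  have htN : t ^ N = 1 := by
    rw [ht, mul_pow, ← map_pow, hζ, map_one, one_mul, inv_pow, ← pow_mul, mul_comm, pow_mul, hζ, one_pow, inv_one]
  have := eq_one_of_pow_eq_one_of_valued_sub_one_lt w.1 hN ht1 htN
  rw [ht] at this
  calc galAdicCompletionMap c hw ζ = galAdicCompletionMap c hw ζ * (ζ ^ q)⁻¹ * ζ ^ q := by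
        rw [mul_assoc, inv_mul_cancel₀ hζq0, mul_one]
    _ = ζ ^ q := by rw [this, one_mul]

end Frobenius

/-! ## §3 `E_w¹` is `N`-DIVISIBLE at an inert TAME place with `gcd(N, q_v + 1) = 1` -/

section Divisible

variable {F : Type} (E : Type) [Field F] [NumberField F] [Field E] [NumberField E] [Algebra F E]
  [Algebra.IsQuadraticExtension F E] (c : E ≃ₐ[F] E) (v : HeightOneSpectrum (𝓞 F))

/-- **`E_w¹ = (E_w¹)^N` at an inert tame place with `gcd(N, q_v + 1) = 1`.**  Let `v` be unramified in `E`, `w ∣ v` with `c • w = w`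
(`c_w = galAdicCompletionMap c hw` the conjugation of `E_w`), and let `N ≥ 1` be a unit at `w` (`v_w(N) = 1`) and coprime to `q_v + 1`.  Then every
`z ∈ E_w` with `z · c_w(z) = 1` is `y^N` for some `y ∈ E_w` with `y · c_w(y) = 1`.  PROOF: approximate `z` by a global `u ∈ 𝓞_E` (density); then
`u · c(u) ≡ 1`, so `\bar u ∈ κ(w)¹`, which is `N`-divisible (`#κ(w)¹ = q_v + 1` prime to `N`, ✔ `…InertFrobenius` §5) and generated by classes of
`u' ∕ c(u')`: `u ≡ (u' ∕ c u')^N (mod 𝔭_w)`; with the global norm-one `g = u' ∕ c(u')`, `z' = z ∕ g^N` is a norm-one PRINCIPAL unit, hence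
`z' = r^N` by Hensel (✔ `exists_pow_eq_of_norm_sub_one_lt`); `t = r · c_w(r)` is an `N`-th root of unity and `c_w` acts on `N`-th roots of unity
as `ζ ↦ ζ^{q_v}` (§2), so for `ζ = t^{−b}` with `a N + b (q_v + 1) = 1` one has `ζ · c_w(ζ) = ζ^{q_v + 1} = t^{−1}` and `r ζ` is norm-one with
`(r ζ)^N = z'`; `y = g · r ζ`. [cite: NeukirchANT1999, Ch. II §4 Lemma (4.6) and §5 Prop. (5.3); Ch. I §9 Exercise 2] -/
theorem exists_pow_eq_of_mul_galAdicCompletionMap_eq_one (hc : c ≠ 1) (hv : Algebra.IsUnramifiedIn (𝓞 E) v.asIdeal)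
    (w : PlacesOver E v) (hw : c • w.1 = w.1) {N : ℕ} (hN0 : N ≠ 0) (hNv : Valued.v ((N : w.1.adicCompletion E)) = 1)
    (hNq : Nat.Coprime N (Nat.card (𝓞 F ⧸ v.asIdeal) + 1)) (z : w.1.adicCompletion E)
    (hz : z * galAdicCompletionMap c hw z = 1) :
    ∃ y : w.1.adicCompletion E, y * galAdicCompletionMap c hw y = 1 ∧ y ^ N = z := by
  classical
  haveI : w.1.asIdeal.IsMaximal := w.1.isMaximal
  letI : Field (𝓞 E ⧸ w.1.asIdeal) := Ideal.Quotient.field _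
  set q := Nat.card (𝓞 F ⧸ v.asIdeal) with hq
  have hcc : c * c = 1 :=
    Literature.NumberTheory.GaloisRepresentations.HeckeCharacter.CMQuadraticExtension.mul_self_eq_one c
      (Algebra.IsQuadraticExtension.finrank_eq_two F E) hc
  -- notation-free abbreviations
  have hvcw : ∀ x : w.1.adicCompletion E, Valued.v (galAdicCompletionMap c hw x) = Valued.v x := fun x =>
    valued_galAdicCompletionMap E c hw x
  have hval : ∀ x : 𝓞 E, Valued.v (((x : 𝓞 E) : E) : w.1.adicCompletion E) = w.1.intValuation x := fun x => by
    rw [HeightOneSpectrum.valuedAdicCompletion_eq_valuation', RingOfIntegers.coe_eq_algebraMap,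
      HeightOneSpectrum.valuation_of_algebraMap]
  have hcoe : ∀ x : 𝓞 E, galAdicCompletionMap c hw (((x : 𝓞 E) : E) : w.1.adicCompletion E) =
      (((c • x : 𝓞 E) : E) : w.1.adicCompletion E) := fun x => by
    rw [galAdicCompletionMap_coe_algEquiv]; rfl
  have hsubE : ∀ x y : 𝓞 E, (((x - y : 𝓞 E) : E) : w.1.adicCompletion E) =
      (((x : 𝓞 E) : E) : w.1.adicCompletion E) - (((y : 𝓞 E) : E) : w.1.adicCompletion E) := fun x y => by
    have h1 : ((x - y : 𝓞 E) : E) = ((x : 𝓞 E) : E) - ((y : 𝓞 E) : E) := by push_cast; rfl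
    change algebraMap E (w.1.adicCompletion E) ((x - y : 𝓞 E) : E) =
      algebraMap E (w.1.adicCompletion E) ((x : 𝓞 E) : E) - algebraMap E (w.1.adicCompletion E) ((y : 𝓞 E) : E)
    rw [h1, map_sub]
  have hmulE : ∀ x y : 𝓞 E, (((x * y : 𝓞 E) : E) : w.1.adicCompletion E) =
      (((x : 𝓞 E) : E) : w.1.adicCompletion E) * (((y : 𝓞 E) : E) : w.1.adicCompletion E) := fun x y => by
    have h1 : ((x * y : 𝓞 E) : E) = ((x : 𝓞 E) : E) * ((y : 𝓞 E) : E) := by push_cast; rfl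
    change algebraMap E (w.1.adicCompletion E) ((x * y : 𝓞 E) : E) =
      algebraMap E (w.1.adicCompletion E) ((x : 𝓞 E) : E) * algebraMap E (w.1.adicCompletion E) ((y : 𝓞 E) : E)
    rw [h1, map_mul]
  have hpowE : ∀ (x : 𝓞 E) (k : ℕ), (((x ^ k : 𝓞 E) : E) : w.1.adicCompletion E) =
      (((x : 𝓞 E) : E) : w.1.adicCompletion E) ^ k := fun x k => by
    have h1 : ((x ^ k : 𝓞 E) : E) = ((x : 𝓞 E) : E) ^ k := by push_cast; rfl
    change algebraMap E (w.1.adicCompletion E) ((x ^ k : 𝓞 E) : E) = (algebraMap E (w.1.adicCompletion E) ((x : 𝓞 E) : E)) ^ k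
    rw [h1, map_pow]
  have honeE : (((1 : 𝓞 E) : E) : w.1.adicCompletion E) = 1 := by
    change algebraMap E (w.1.adicCompletion E) ((1 : 𝓞 E) : E) = 1
    rw [RingOfIntegers.coe_eq_algebraMap, map_one, map_one]
  -- (1) `v(z) = 1`
  have hz1 : Valued.v z = 1 := by
    have h := congrArg Valued.v hz
    rw [Valuation.map_mul, hvcw, Valuation.map_one, ← sq] at h
    exact (pow_eq_one_iff_left two_ne_zero).1 h
  have hz0 : z ≠ 0 := fun h => by rw [h, Valuation.map_zero] at hz1; exact zero_ne_one hz1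
  -- (2) a global approximant `u`
  obtain ⟨u, hu⟩ := Literature.NumberTheory.Automorphic.exists_ringOfIntegers_valued_sub_lt_one E w.1 ⟨z, hz1.le⟩
  set ub : w.1.adicCompletion E := (((u : 𝓞 E) : E) : w.1.adicCompletion E) with hub
  change Valued.v (ub - z) < 1 at hu
  have hub1 : Valued.v ub = 1 := by
    have h := Valuation.map_add_eq_of_lt_left Valued.v (x := z) (y := ub - z) (by rw [hz1]; exact hu)
    rwa [add_sub_cancel, hz1] at h
  have huw : u ∉ w.1.asIdeal := by
    rw [← HeightOneSpectrum.intValuation_eq_one_iff, ← hval]; exact hub1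
  -- (3) `u · (c • u) ≡ 1 (mod 𝔭_w)`
  have h3 : u * (c • u) - 1 ∈ w.1.asIdeal := by
    rw [← HeightOneSpectrum.intValuation_lt_one_iff_mem, ← hval, hsubE, hmulE, honeE, ← hcoe]
    have hrw : ub * galAdicCompletionMap c hw ub - 1 =
        (ub - z) * galAdicCompletionMap c hw ub + z * galAdicCompletionMap c hw (ub - z) := by
      rw [map_sub, ← hz]; ring
    rw [hrw]
    refine (Valuation.map_add _ _ _).trans_lt (max_lt ?_ ?_)
    · rw [Valuation.map_mul, hvcw, hub1, mul_one]; exact hu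
    · rw [Valuation.map_mul, hz1, one_mul, hvcw]; exact hu
  -- (4) the residue class of `u` is `(u' ∕ c u')^N` modulo `𝔭_w`
  have hxu0 : Ideal.Quotient.mk w.1.asIdeal u ≠ 0 := fun h => huw (Ideal.Quotient.eq_zero_iff_mem.1 h)
  set xu : (𝓞 E ⧸ w.1.asIdeal)ˣ := Units.mk0 _ hxu0 with hxu
  have hxu1 : xu ^ (q + 1) = 1 := by
    apply Units.ext
    rw [Units.val_pow_eq_pow_val, hxu, Units.val_mk0, Units.val_one, ← map_pow, ← map_one (Ideal.Quotient.mk w.1.asIdeal)]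
    exact Ideal.Quotient.eq.2 (LemD1IndexedNonVacuityInertFrobenius.pow_card_succ_sub_one_mem E c v hc hv w hw u h3)
  obtain ⟨yb, hyb1, hybN⟩ := LemD1IndexedNonVacuityInertFrobenius.exists_pow_eq_of_coprime_card_succ E c v hc hv w hw hNq xu hxu1
  obtain ⟨u', hu'w, hu'⟩ :=
    LemD1IndexedNonVacuityInertFrobenius.exists_mul_mk_smul_eq_mk_of_pow_card_succ_eq_one E c v hc hv w hw yb hyb1
  have hcu'w : c • u' ∉ w.1.asIdeal := fun h =>
    hu'w ((LemD1IndexedNonVacuityInertFrobenius.smul_mem_asIdeal_iff_of_smul_eq E c v w hw u').1 h)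
  have h4 : u * (c • u') ^ N - u' ^ N ∈ w.1.asIdeal := by
    refine Ideal.Quotient.eq.1 ?_
    rw [map_mul, map_pow, map_pow, ← hu', mul_pow, ← Units.val_pow_eq_pow_val, hybN, hxu, Units.val_mk0]
  -- (5) the global norm-one `g = u' ∕ c(u')` and its image in `E_w`
  set a' : w.1.adicCompletion E := (((u' : 𝓞 E) : E) : w.1.adicCompletion E) with ha'
  set b' : w.1.adicCompletion E := (((c • u' : 𝓞 E) : E) : w.1.adicCompletion E) with hb'
  have ha'1 : Valued.v a' = 1 := by rw [ha', hval, HeightOneSpectrum.intValuation_eq_one_iff]; exact hu'w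
  have hb'1 : Valued.v b' = 1 := by rw [hb', hval, HeightOneSpectrum.intValuation_eq_one_iff]; exact hcu'w
  have ha'0 : a' ≠ 0 := fun h => by rw [h, Valuation.map_zero] at ha'1; exact zero_ne_one ha'1
  have hb'0 : b' ≠ 0 := fun h => by rw [h, Valuation.map_zero] at hb'1; exact zero_ne_one hb'1
  have hca' : galAdicCompletionMap c hw a' = b' := by rw [ha', hcoe]
  have hcb' : galAdicCompletionMap c hw b' = a' := by
    rw [hb', hcoe]
    have : c • (c • u') = u' := by rw [smul_smul, hcc, one_smul]
    rw [this]
  set g : w.1.adicCompletion E := a' * b'⁻¹ with hg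
  have hgc : g * galAdicCompletionMap c hw g = 1 := by
    rw [hg, map_mul, map_inv₀, hca', hcb']
    field_simp
  have hg1 : Valued.v g = 1 := by rw [hg, Valuation.map_mul, map_inv₀, ha'1, hb'1, inv_one, mul_one]
  have hg0 : g ≠ 0 := fun h => by rw [h, Valuation.map_zero] at hg1; exact zero_ne_one hg1
  have hgN0 : g ^ N ≠ 0 := pow_ne_zero _ hg0
  have hugN : Valued.v (ub - g ^ N) < 1 := by
    have hrw : ub - g ^ N = (ub * b' ^ N - a' ^ N) * (b' ^ N)⁻¹ := by
      rw [hg, mul_pow, inv_pow, sub_mul, mul_assoc, mul_inv_cancel₀ (pow_ne_zero _ hb'0), mul_one]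
    have hnum : ub * b' ^ N - a' ^ N = (((u * (c • u') ^ N - u' ^ N : 𝓞 E) : E) : w.1.adicCompletion E) := by
      rw [hsubE, hmulE, hpowE, hpowE]
    rw [hrw, Valuation.map_mul, map_inv₀, Valuation.map_pow, hb'1, one_pow, inv_one, mul_one, hnum, hval,
      HeightOneSpectrum.intValuation_lt_one_iff_mem]
    exact h4
  -- (6) `z' = z ∕ g^N` is a norm-one principal unit
  set z' : w.1.adicCompletion E := z * (g ^ N)⁻¹ with hz'
  have hz'c : z' * galAdicCompletionMap c hw z' = 1 := by
    have hgNc : g ^ N * galAdicCompletionMap c hw (g ^ N) = 1 := by rw [map_pow, ← mul_pow, hgc, one_pow]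
    rw [hz', map_mul, map_inv₀]
    calc z * (g ^ N)⁻¹ * (galAdicCompletionMap c hw z * (galAdicCompletionMap c hw (g ^ N))⁻¹)
        = (z * galAdicCompletionMap c hw z) * (g ^ N * galAdicCompletionMap c hw (g ^ N))⁻¹ := by
          rw [mul_inv]; ring
      _ = 1 := by rw [hz, hgNc, inv_one, mul_one]
  have hz'1 : Valued.v (z' - 1) < 1 := by
    have hrw : z' - 1 = (z - g ^ N) * (g ^ N)⁻¹ := by rw [hz', sub_mul, mul_inv_cancel₀ hgN0]
    rw [hrw, Valuation.map_mul, map_inv₀, Valuation.map_pow, hg1, one_pow, inv_one, mul_one]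
    have : z - g ^ N = (z - ub) + (ub - g ^ N) := by ring
    rw [this]
    refine (Valuation.map_add _ _ _).trans_lt (max_lt ?_ hugN)
    rw [Valuation.map_sub_swap]; exact hu
  -- (7) Hensel: `z' = r^N`
  have hunit : IsUnit ((N : ℕ) : w.1.adicCompletionIntegers E) := by
    by_contra hnu
    have hmem : ((N : ℕ) : w.1.adicCompletionIntegers E) ∈ IsLocalRing.maximalIdeal (w.1.adicCompletionIntegers E) := hnu
    rw [Literature.NumberTheory.GaloisRepresentations.mem_maximalIdeal_adicCompletionIntegers_iff,
      Valued.toNormedField.norm_lt_one_iff] at hmem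
    have : Valued.v ((N : w.1.adicCompletion E)) < 1 := by simpa using hmem
    rw [hNv] at this
    exact lt_irrefl _ this
  obtain ⟨r, hr⟩ := Literature.NumberTheory.GaloisRepresentations.exists_pow_eq_of_norm_sub_one_lt E w.1
    ((Valued.toNormedField.norm_lt_one_iff).2 hz'1) hunit
  -- (8) correct `r` by an `N`-th root of unity
  set t : w.1.adicCompletion E := r * galAdicCompletionMap c hw r with ht
  have htN : t ^ N = 1 := by rw [ht, mul_pow, ← map_pow, hr, hz'c]
  have ht0 : t ≠ 0 := fun h => by rw [h, zero_pow hN0] at htN; exact zero_ne_one htN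
  obtain ⟨a, b, hab⟩ := (Nat.Coprime.isCoprime hNq)  -- a * N + b * (q+1) = 1 in ℤ
  set ζ : w.1.adicCompletion E := t ^ (-b) with hζ
  have hζN : ζ ^ N = 1 := by
    rw [hζ, ← zpow_natCast, ← zpow_mul, mul_comm, zpow_mul, zpow_natCast, htN, one_zpow]
  have hζq : ζ ^ (q + 1) = t⁻¹ := by
    have hexp : (-b) * ((q + 1 : ℕ) : ℤ) = a * (N : ℤ) - 1 := by linear_combination (-1 : ℤ) * hab
    rw [hζ, ← zpow_natCast, ← zpow_mul, hexp, zpow_sub₀ ht0, zpow_one, mul_comm a, zpow_mul, zpow_natCast, htN,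
      one_zpow, one_div]
  have hcζ : galAdicCompletionMap c hw ζ = ζ ^ q :=
    galAdicCompletionMap_eq_pow_of_pow_eq_one E c v hc hv w hw hN0 hNv hζN
  set r' : w.1.adicCompletion E := r * ζ with hr'
  have hr'c : r' * galAdicCompletionMap c hw r' = 1 := by
    rw [hr', map_mul, hcζ]
    calc r * ζ * (galAdicCompletionMap c hw r * ζ ^ q) = (r * galAdicCompletionMap c hw r) * ζ ^ (q + 1) := by ring
      _ = 1 := by rw [← ht, hζq, mul_inv_cancel₀ ht0]
  have hr'N : r' ^ N = z' := by rw [hr', mul_pow, hζN, mul_one, hr]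
  -- (9) `y = g · r'`
  refine ⟨g * r', ?_, ?_⟩
  · rw [map_mul]
    calc g * r' * (galAdicCompletionMap c hw g * galAdicCompletionMap c hw r')
        = (g * galAdicCompletionMap c hw g) * (r' * galAdicCompletionMap c hw r') := by ring
      _ = 1 := by rw [hgc, hr'c, one_mul]
  · rw [mul_pow, hr'N, hz', mul_comm, mul_assoc, inv_mul_cancel₀ hgN0, mul_one]

end Divisible

/-! ## §4 The place model: `S.normOne = E_v¹` is `N`-divisible at an inert tame place with `gcd(N, q_v + 1) = 1`; hence NO det-line
carrier with trivial central character -/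

section PlaceModel

variable {F : Type} (E : Type) [Field F] [NumberField F] [Field E] [NumberField E] [Algebra F E]
  [Algebra.IsQuadraticExtension F E] (v : HeightOneSpectrum (𝓞 F)) (c : E ≃ₐ[F] E)
  {δ : E} (hcδ : c δ = -δ) (hδ : δ ≠ 0)
  (N : ℕ) (J : Matrix (Fin N) (Fin N) E) (hN : 2 ≤ N) (hJh : (J.map c)ᵀ = J) (hJdet : J.det ≠ 0)

omit [NumberField F] [Algebra.IsQuadraticExtension F E] in
include hcδ hδ in
/-- `c ≠ 1` (`c δ = −δ ≠ δ`); copy of the siblings' private lemma. [folklore] -/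
private theorem hc_of_delta : c ≠ 1 := by
  rintro rfl
  rw [AlgEquiv.one_apply] at hcδ
  have h2 : (2 : E) * δ = 0 := by linear_combination hcδ
  exact hδ ((mul_eq_zero.mp h2).resolve_left two_ne_zero)

include hcδ hδ in
/-- `((c ⊗ 1) x)_w = c_w(x_w)` at a non-split place (`w` is the only place above `v`); copy of the siblings' private lemma.
[cite: CasselsFrohlichANT1967, Ch. II §10] -/
private theorem conjLocal_apply_of_smul_eq (w : PlacesOver E v) (hw : c • w.1 = w.1) (x : LocalRing E v) :
    conjLocal E c v x w = galAdicCompletionMap c hw (x w) := by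
  have key : ∀ (w₁ : PlacesOver E v) (h₁ : c • w₁.1 = w.1),
      galAdicCompletionMap c h₁ (x w₁) = galAdicCompletionMap c hw (x w) := by
    intro w₁ h₁
    have e : w₁ = w := PlacesOver.eq_of_smul_eq c (hc_of_delta E c hcδ hδ) w hw w₁
    subst e
    rfl
  rw [conjLocal_apply]
  exact key ⟨c⁻¹ • w.1, under_inv_smul_eq c w⟩ (smul_inv_smul c w.1)

/-- determinants of `U(V)(F_v)` are norm-one; copy of the siblings' private lemma. [cite: Liu2021, App. D §D.1 (l. 5213)] [cite: Mok2014, §1 Notation p. 5] -/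
private theorem det_mem_normOne (g : (LemD1OfPlace.standingData E v c N J hcδ hδ hN hJh hJdet).U) :
    Matrix.GeneralLinearGroup.det (g : GL (Fin N) (LocalRing E v)) ∈ (LemD1OfPlace.standingData E v c N J hcδ hδ hN hJh hJdet).normOne := by
  let S := LemD1OfPlace.standingData E v c N J hcδ hδ hN hJh hJdet
  rw [OscillatorStandingData.mem_normOne_iff', Matrix.GeneralLinearGroup.val_det_apply]
  have hg := (OscillatorStandingData.mem_U_iff S _).1 g.2
  have h := congrArg Matrix.det hg
  rw [Matrix.det_mul, Matrix.det_mul, Matrix.det_transpose] at h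
  have hc : (((g : GL (Fin N) (LocalRing E v)) : Matrix (Fin N) (Fin N) (LocalRing E v)).map S.conj).det =
      S.conj (((g : GL (Fin N) (LocalRing E v)) : Matrix (Fin N) (Fin N) (LocalRing E v)).det) := by
    rw [AlgEquiv.map_det, AlgEquiv.mapMatrix_apply]
  rw [hc] at h
  have h2 : (((g : GL (Fin N) (LocalRing E v)) : Matrix (Fin N) (Fin N) (LocalRing E v)).det *
      S.conj (((g : GL (Fin N) (LocalRing E v)) : Matrix (Fin N) (Fin N) (LocalRing E v)).det) - 1) * S.gram.det = 0 := by
    linear_combination h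
  exact sub_eq_zero.1 ((S.isUnit_det_gram.mul_left_eq_zero).1 h2)

include hcδ in
/-- **`E_v¹ = (E_v¹)^N` in the place model at an inert TAME place with `gcd(N, q_v + 1) = 1`**: for `v` unramified in `E`, `w ∣ v` with
`c • w = w`, `v_w(N) = 1` and `N` coprime to `q_v + 1`, every `z ∈ S.normOne = E_v¹` is the `N`-th power of an element of `S.normOne`
(§3 at the component `w`, which determines an element of `E_v = Π_{w' ∣ v} E_{w'}` since `w` is the only place above `v`).
[cite: NeukirchANT1999, Ch. II §4 Lemma (4.6) and §5 Prop. (5.3); Ch. I §9 Exercise 2] [cite: Liu2021, App. D §D.1 Step 3 (l. 5221)] -/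
theorem exists_pow_eq_of_mem_normOne (hv : Algebra.IsUnramifiedIn (𝓞 E) v.asIdeal) (w : PlacesOver E v) (hw : c • w.1 = w.1)
    (hNv : Valued.v ((N : w.1.adicCompletion E)) = 1) (hNq : Nat.Coprime N (Nat.card (𝓞 F ⧸ v.asIdeal) + 1))
    (z : (LemD1OfPlace.standingData E v c N J hcδ hδ hN hJh hJdet).normOne) :
    ∃ y : (LemD1OfPlace.standingData E v c N J hcδ hδ hN hJh hJdet).normOne, y ^ N = z := by
  classical
  have hc : c ≠ 1 := hc_of_delta E c hcδ hδ
  have hN0 : N ≠ 0 := by omega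
  let S := LemD1OfPlace.standingData E v c N J hcδ hδ hN hJh hJdet
  -- the component at `w`
  set zw : w.1.adicCompletion E := ((z : (LocalRing E v)ˣ) : LocalRing E v) w with hzw
  have hzc : zw * galAdicCompletionMap c hw zw = 1 := by
    have h := congrFun (LemD1OfPlace.mul_conjLocal_eq_one E v c N J hcδ hδ hN hJh hJdet z) w
    rw [Pi.mul_apply, conjLocal_apply_of_smul_eq E v c hcδ hδ w hw, Pi.one_apply] at h
    exact h
  obtain ⟨yw, hyc, hyN⟩ :=
    exists_pow_eq_of_mul_galAdicCompletionMap_eq_one E c v hc hv w hw hN0 hNv hNq zw hzc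
  -- spread `yw` over the (one-element) index type
  letI : Unique (PlacesOver E v) := { default := w, uniq := fun a => PlacesOver.eq_of_smul_eq c hc w hw a }
  let y : LocalRing E v := uniqueElim (α := fun w' : PlacesOver E v => w'.1.adicCompletion E) yw
  have hyw : y w = yw := uniqueElim_default (α := fun w' : PlacesOver E v => w'.1.adicCompletion E) yw
  have hy1 : y * conjLocal E c v y = 1 := by
    rw [LocalRing.eq_iff_apply_eq c hc w hw]
    rw [Pi.mul_apply, conjLocal_apply_of_smul_eq E v c hcδ hδ w hw, hyw, Pi.one_apply]
    exact hyc
  have hyu : IsUnit y := IsUnit.of_mul_eq_one (conjLocal E c v y) hy1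
  have hmem : hyu.unit ∈ S.normOne := by
    rw [OscillatorStandingData.mem_normOne_iff', LemD1OfPlace.standingData_conj_apply, IsUnit.unit_spec]
    exact hy1
  refine ⟨⟨hyu.unit, hmem⟩, ?_⟩
  apply Subtype.ext
  apply Units.ext
  rw [SubgroupClass.coe_pow, Units.val_pow_eq_pow_val, IsUnit.unit_spec, LocalRing.eq_iff_apply_eq c hc w hw, Pi.pow_apply, hyw,
    hyN]

include hcδ in
/-- **every character of `E_v¹` killed by the `N`-th powers is trivial** at an inert tame place with `gcd(N, q_v + 1) = 1`.
[cite: NeukirchANT1999, Ch. II §5 Prop. (5.3)] [cite: Liu2021, App. D §D.1 Step 3 (l. 5221)] -/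
theorem forall_apply_eq_one_of_forall_pow (hv : Algebra.IsUnramifiedIn (𝓞 E) v.asIdeal) (w : PlacesOver E v)
    (hw : c • w.1 = w.1) (hNv : Valued.v ((N : w.1.adicCompletion E)) = 1) (hNq : Nat.Coprime N (Nat.card (𝓞 F ⧸ v.asIdeal) + 1))
    (θ : (LemD1OfPlace.standingData E v c N J hcδ hδ hN hJh hJdet).normOne →* ℂˣ)
    (hθ : ∀ z : (LemD1OfPlace.standingData E v c N J hcδ hδ hN hJh hJdet).normOne, θ (z ^ N) = 1)
    (z : (LemD1OfPlace.standingData E v c N J hcδ hδ hN hJh hJdet).normOne) : θ z = 1 := by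
  obtain ⟨y, rfl⟩ := exists_pow_eq_of_mem_normOne E v c hcδ hδ N J hN hJh hJdet hv w hw hNv hNq z
  exact hθ y

include hcδ in
/-- **NO DET-LINE CARRIER at an inert TAME place with `gcd(N, q_v + 1) = 1`.**  Let `v` be unramified in `E`, `w ∣ v` with `c • w = w`,
`v_w(N) = 1` and `gcd(N, q_v + 1) = 1`.  Then every character `Ψ` of `U(V)(F_v) = S.U` that FACTORS THROUGH `det : U(V)(F_v) → E_v¹`
(`Ψ = θ ∘ det`) and is trivial on the centre `S.scalar(E_v¹)` is TRIVIAL — because `det(z · 1_N) = z^N` forces `θ` to kill `(E_v¹)^N = E_v¹`.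
This is the exact negation of the conclusion of ✔ `…InertCarrier.exists_inert_carrier_character` (there `gcd(N, q_v + 1) > 1`): at such places
the `μ`-conjunct of [Lem. D.1 (3)] AS PRINTED cannot be separated by the siblings' det-line device — for the END's `N = 3`: the inert places
`v ∤ 3` of `L⁺` with `q_v ≡ 0, 1 (mod 3)`. [cite: Liu2021, App. D §D.1 Step 3 (l. 5221) and Lemma D.1 (3) (l. 5233)]
[cite: NeukirchANT1999, Ch. II §4 Lemma (4.6)] -/
theorem eq_one_of_factors_through_det (hv : Algebra.IsUnramifiedIn (𝓞 E) v.asIdeal) (w : PlacesOver E v) (hw : c • w.1 = w.1)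
    (hNv : Valued.v ((N : w.1.adicCompletion E)) = 1) (hNq : Nat.Coprime N (Nat.card (𝓞 F ⧸ v.asIdeal) + 1))
    (Ψ : (LemD1OfPlace.standingData E v c N J hcδ hδ hN hJh hJdet).U →* ℂˣ)
    (θ : (LemD1OfPlace.standingData E v c N J hcδ hδ hN hJh hJdet).normOne →* ℂˣ)
    (hΨ : ∀ (g : (LemD1OfPlace.standingData E v c N J hcδ hδ hN hJh hJdet).U)
      (hg : Matrix.GeneralLinearGroup.det (g : GL (Fin N) (LocalRing E v)) ∈
        (LemD1OfPlace.standingData E v c N J hcδ hδ hN hJh hJdet).normOne),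
      Ψ g = θ ⟨Matrix.GeneralLinearGroup.det (g : GL (Fin N) (LocalRing E v)), hg⟩)
    (hcen : ∀ z : (LemD1OfPlace.standingData E v c N J hcδ hδ hN hJh hJdet).normOne,
      Ψ ((LemD1OfPlace.standingData E v c N J hcδ hδ hN hJh hJdet).scalar z) = 1) :
    Ψ = 1 := by
  let S := LemD1OfPlace.standingData E v c N J hcδ hδ hN hJh hJdet
  -- `det (z · 1_N) = z^N`, so `θ` kills the `N`-th powers
  have hdet : ∀ z : S.normOne, (⟨Matrix.GeneralLinearGroup.det ((S.scalar z : S.U) : GL (Fin N) (LocalRing E v)),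
      det_mem_normOne E v c hcδ hδ N J hN hJh hJdet (S.scalar z)⟩ : S.normOne) = z ^ N := fun z => by
    apply Subtype.ext
    rw [SubgroupClass.coe_pow]
    apply Units.ext
    rw [Matrix.GeneralLinearGroup.val_det_apply, OscillatorStandingData.coe_scalar, Matrix.scalar_apply, Matrix.det_diagonal,
      Finset.prod_const, Finset.card_univ, Fintype.card_fin, Units.val_pow_eq_pow_val]
  have hθ : ∀ z : S.normOne, θ (z ^ N) = 1 := fun z => by
    rw [← hdet z, ← hΨ (S.scalar z) (det_mem_normOne E v c hcδ hδ N J hN hJh hJdet (S.scalar z))]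
    exact hcen z
  ext g
  rw [hΨ g (det_mem_normOne E v c hcδ hδ N J hN hJh hJdet g), MonoidHom.one_apply,
    forall_apply_eq_one_of_forall_pow E v c hcδ hδ N J hN hJh hJdet hv w hw hNv hNq θ hθ]

end PlaceModel

/-! ## §5 The CM rows: `L` CM, `F = L⁺`, `c` = complex conjugation -/

section CM

open Literature.NumberTheory.GelbartRogawski1991.UnitaryDualPair (imagUnit complexConj_imagUnit imagUnit_ne_zero)

variable (L : Type) [Field L] [NumberField L] [IsCMField L]

local notation3 "cc" => (IsCMField.complexConj L)
local notation3 "L⁺" => (↥(maximalRealSubfield L))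

variable (v : HeightOneSpectrum (𝓞 (maximalRealSubfield L))) (N : ℕ) (J : Matrix (Fin N) (Fin N) L) (hN : 2 ≤ N)
  (hJh : (J.map (IsCMField.complexConj L))ᵀ = J) (hJdet : J.det ≠ 0)

/-- **CM form: `E_v¹` of the rows' standing data is `N`-divisible at every inert tame place `w ∣ v` of `L` (`v` unramified in `L`,
`\bar w = w`, `v_w(N) = 1`) with `gcd(N, q_v + 1) = 1`.** [cite: NeukirchANT1999, Ch. II §4 Lemma (4.6)] [cite: Liu2021, App. D §D.1 Step 3 (l. 5221)] -/
theorem exists_pow_eq_of_mem_normOne_of_isCMField (hv : Algebra.IsUnramifiedIn (𝓞 L) v.asIdeal) (w : PlacesOver L v)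
    (hw : cc • w.1 = w.1) (hNv : Valued.v ((N : w.1.adicCompletion L)) = 1)
    (hNq : Nat.Coprime N (Nat.card (𝓞 L⁺ ⧸ v.asIdeal) + 1))
    (z : (LemD1OfPlace.standingData L v cc N J (complexConj_imagUnit L) (imagUnit_ne_zero L) hN hJh hJdet).normOne) :
    ∃ y : (LemD1OfPlace.standingData L v cc N J (complexConj_imagUnit L) (imagUnit_ne_zero L) hN hJh hJdet).normOne, y ^ N = z :=
  exists_pow_eq_of_mem_normOne L v cc (complexConj_imagUnit L) (imagUnit_ne_zero L) N J hN hJh hJdet hv w hw hNv hNq z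

/-- **CM form of «NO det-line carrier»**: at every inert tame place of `L⁺` with `gcd(N, q_v + 1) = 1` every character of `U(V)(L⁺_v)` factoring
through `det` and trivial on the centre is trivial — for the END's `N = 3`: the inert `v ∤ 3` (unramified in `L`) with `q_v ≢ 2 (mod 3)`.
[cite: Liu2021, App. D §D.1 Step 3 (l. 5221) and Lemma D.1 (3) (l. 5233)] [cite: NeukirchANT1999, Ch. II §4 Lemma (4.6)] -/
theorem eq_one_of_factors_through_det_of_isCMField (hv : Algebra.IsUnramifiedIn (𝓞 L) v.asIdeal) (w : PlacesOver L v)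
    (hw : cc • w.1 = w.1) (hNv : Valued.v ((N : w.1.adicCompletion L)) = 1)
    (hNq : Nat.Coprime N (Nat.card (𝓞 L⁺ ⧸ v.asIdeal) + 1))
    (Ψ : (LemD1OfPlace.standingData L v cc N J (complexConj_imagUnit L) (imagUnit_ne_zero L) hN hJh hJdet).U →* ℂˣ)
    (θ : (LemD1OfPlace.standingData L v cc N J (complexConj_imagUnit L) (imagUnit_ne_zero L) hN hJh hJdet).normOne →* ℂˣ)
    (hΨ : ∀ (g : (LemD1OfPlace.standingData L v cc N J (complexConj_imagUnit L) (imagUnit_ne_zero L) hN hJh hJdet).U)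
      (hg : Matrix.GeneralLinearGroup.det (g : GL (Fin N) (LocalRing L v)) ∈
        (LemD1OfPlace.standingData L v cc N J (complexConj_imagUnit L) (imagUnit_ne_zero L) hN hJh hJdet).normOne),
      Ψ g = θ ⟨Matrix.GeneralLinearGroup.det (g : GL (Fin N) (LocalRing L v)), hg⟩)
    (hcen : ∀ z : (LemD1OfPlace.standingData L v cc N J (complexConj_imagUnit L) (imagUnit_ne_zero L) hN hJh hJdet).normOne,
      Ψ ((LemD1OfPlace.standingData L v cc N J (complexConj_imagUnit L) (imagUnit_ne_zero L) hN hJh hJdet).scalar z) = 1) :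
    Ψ = 1 :=
  eq_one_of_factors_through_det L v cc (complexConj_imagUnit L) (imagUnit_ne_zero L) N J hN hJh hJdet hv w hw hNv hNq Ψ θ hΨ hcen

end CM

end Literature.NumberTheory.Automorphic.Liu2021.LemD1IndexedNonVacuityInertConverse

end
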